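import Mathlib
import Literature.Probability.RandomPlanarGeometry.ChordalCurveFamily
import Literature.Probability.RandomPlanarGeometry.CurveClassStopAtMeasurable
import HarnessLib

/-!
# The `markov` clause of a domain-Markov extension from tensor test functions

Crux `AxiomsOfLimit` (stmt-CriticalPhenomena-1370), line `registered` (= `split`), stub `stub_markovOfLimit`
(the restriction-coupled domain-Markov kernel of the SAW scaling limit): CONTINUUM HALF of the Markov passage,
part 1 (lead c3).

The `markov` clause of `ChordalFamily.IsMarkovExtension P Q` asks, for every closed `F ⊆ ℂ` and all Borel
`S, T ⊆ CurveClass ℂ`,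

  `P D (stopAt F ⁻¹' S ∩ startFrom F ⁻¹' T) = ∫⁻ γ in stopAt F ⁻¹' S, Q D (γ.stopAt F) T ∂(P D)`,

i.e. that `Q D` disintegrates `P D` along `γ ↦ (γ.stopAt F, γ.startFrom F)`. A kernel obtained as a weak LIMIT of
lattice conditional laws is only known through integrals of bounded continuous functions (`TendstoLaw`). This
file proves that the test-function form suffices:

* `measure_inter_preimage_eq_setLIntegral_kernel_of_forall_integral` — for measurable `X : Ω → A`,
  `Y : Ω → B` into Borel spaces with outer-approximable closed sets (e.g. metric spaces), a finite measure `μ`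
  and a finite kernel `κ`, the identity `∫ f(X) g(Y) dμ = ∫ f(X) · (∫ g dκ(X)) dμ` over real bounded continuous
  `f, g` gives `μ (X ⁻¹' S ∩ Y ⁻¹' T) = ∫⁻ ω in X ⁻¹' S, κ (X ω) T ∂μ` for all measurable `S, T` (both sides
  are the finite measures `μ ∘ (X, Y)⁻¹` and `(μ ∘ X⁻¹) ⊗ₘ κ` on `A × B`, which agree on tensors, hence are
  equal by Mathlib's `Measure.ext_of_integral_mul_boundedContinuousFunction`);
* `markov_clause_of_forall_integral` — the specialisation to `X = stopAt F`, `Y = startFrom F` on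
  `CurveClass ℂ` (Borel measurable for closed `F`: `CurveClass.measurable_stopAt / measurable_startFrom`):
  the `markov` clause at `(D, F)` from the tensor identity;
* `isMarkovExtension_of_forall_integral` — a family of finite kernels satisfying `initial`, `domain` and the
  tensor identities for every `(D, F)` is a Markov extension (`ChordalFamily.IsMarkovExtension`).

References: O. Kallenberg, *Foundations of Modern Probability*, 2nd ed. (2002), Thm 6.3–6.4 (disintegration and
its uniqueness); P. Billingsley, *Convergence of Probability Measures*, 2nd ed. (1999), Thm 1.2; W. Werner,
*Lectures on two-dimensional critical percolation* (2007), §3.2 (2) (domain Markov property). All [folklore].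
-/

noncomputable section

open MeasureTheory ProbabilityTheory Filter Topology Set BoundedContinuousFunction
open scoped NNReal ENNReal

namespace Summit.CriticalPhenomena.SAWScalingLimit.Theorems.AxiomsOfLimitMarkov

/-! ### Disintegration identities from tensor test functions -/

section Kernel

variable {Ω A B : Type*} [MeasurableSpace Ω]
  [TopologicalSpace A] [MeasurableSpace A] [BorelSpace A] [HasOuterApproxClosed A]
  [TopologicalSpace B] [MeasurableSpace B] [BorelSpace B] [HasOuterApproxClosed B]

omit [TopologicalSpace A] [BorelSpace A] [HasOuterApproxClosed A] [HasOuterApproxClosed B] in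
/-- The inner integrals `a ↦ ∫ g dκ(a)` of a real bounded continuous `g` against a kernel are measurable
in `a`. [folklore] -/
theorem measurable_integral_kernel_bcf (κ : Kernel A B) (g : B →ᵇ ℝ) :
    Measurable fun a : A => ∫ b, g b ∂(κ a) :=
  (g.continuous.stronglyMeasurable.integral_kernel (κ := κ)).measurable

/-- **A disintegration identity holds on all measurable rectangles as soon as it holds on tensor test
functions.** Let `μ` be a finite measure on `Ω`, `X : Ω → A`, `Y : Ω → B` measurable, `κ` a finite kernel from
`A` to `B`. If `∫ f(X) g(Y) dμ = ∫ f(X) · (∫ g dκ(X)) dμ` for all real bounded continuous `f, g`, then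
`μ (X ⁻¹' S ∩ Y ⁻¹' T) = ∫⁻ ω in X ⁻¹' S, κ (X ω) T ∂μ` for all measurable `S ⊆ A`, `T ⊆ B`: the law of `(X, Y)` is
`(μ ∘ X⁻¹) ⊗ₘ κ`, i.e. `κ` is a version of the conditional law of `Y` given `X` (Kallenberg 2002, Thm 6.3; the
test-function form is what weak limits deliver). [folklore] -/
theorem measure_inter_preimage_eq_setLIntegral_kernel_of_forall_integral (μ : Measure Ω)
    [IsFiniteMeasure μ] {X : Ω → A} {Y : Ω → B} (hX : Measurable X) (hY : Measurable Y)
    (κ : Kernel A B) [IsFiniteKernel κ]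
    (h : ∀ (f : A →ᵇ ℝ) (g : B →ᵇ ℝ),
      ∫ ω, f (X ω) * g (Y ω) ∂μ = ∫ ω, f (X ω) * (∫ b, g b ∂(κ (X ω))) ∂μ)
    {S : Set A} {T : Set B} (hS : MeasurableSet S) (hT : MeasurableSet T) :
    μ (X ⁻¹' S ∩ Y ⁻¹' T) = ∫⁻ ω in X ⁻¹' S, κ (X ω) T ∂μ := by
  have hXY : Measurable fun ω => (X ω, Y ω) := hX.prodMk hY
  -- the two finite measures on `A × B` agree on tensors, hence are equal
  have key : μ.map (fun ω => (X ω, Y ω)) = (μ.map X) ⊗ₘ κ := by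
    refine Measure.ext_of_integral_mul_boundedContinuousFunction fun f g => ?_
    have hbd : ∀ p : A × B, ‖f p.1 * g p.2‖ ≤ ‖f‖ * ‖g‖ := fun p => by
      rw [norm_mul]
      exact mul_le_mul (f.norm_coe_le_norm _) (g.norm_coe_le_norm _) (norm_nonneg _) (norm_nonneg _)
    have hfgm : Measurable fun p : A × B => f p.1 * g p.2 :=
      (f.continuous.measurable.comp measurable_fst).mul (g.continuous.measurable.comp measurable_snd)
    have hint : Integrable (fun p : A × B => f p.1 * g p.2) ((μ.map X) ⊗ₘ κ) :=
      Integrable.of_bound hfgm.aestronglyMeasurable _ (Eventually.of_forall hbd)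
    rw [integral_map hXY.aemeasurable hfgm.aestronglyMeasurable, Measure.integral_compProd hint]
    have hinner : ∀ a : A, ∫ b, f a * g b ∂(κ a) = f a * ∫ b, g b ∂(κ a) := fun a =>
      integral_const_mul _ _
    simp_rw [hinner]
    have hmeas : AEStronglyMeasurable (fun a : A => f a * ∫ b, g b ∂(κ a)) (μ.map X) :=
      (f.continuous.measurable.mul (measurable_integral_kernel_bcf κ g)).aestronglyMeasurable
    rw [integral_map hX.aemeasurable hmeas]
    exact h f g
  have h1 : μ (X ⁻¹' S ∩ Y ⁻¹' T) = μ.map (fun ω => (X ω, Y ω)) (S ×ˢ T) := by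
    rw [Measure.map_apply hXY (hS.prod hT), mk_preimage_prod]
  rw [h1, key, Measure.compProd_apply_prod hS hT, setLIntegral_map hS (κ.measurable_coe hT) hX]

end Kernel

/-! ### The `markov` clause on `CurveClass ℂ` -/

section Markov

open Literature.Probability.RandomPlanarGeometry

/-- **The `markov` clause of a domain-Markov extension from tensor test functions.** Let `μ` be a finite
Borel measure on `CurveClass ℂ` (e.g. `P D`), `F ⊆ ℂ` closed and `κ` a finite kernel on `CurveClass ℂ` (e.g.
`Q D`). If for all real bounded continuous `f, g : CurveClass ℂ →ᵇ ℝ`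
`∫ f(γ.stopAt F) g(γ.startFrom F) dμ = ∫ f(γ.stopAt F) (∫ g dκ(γ.stopAt F)) dμ`, then for all Borel `S, T`
`μ (stopAt F ⁻¹' S ∩ startFrom F ⁻¹' T) = ∫⁻ γ in stopAt F ⁻¹' S, κ (γ.stopAt F) T ∂μ` — literally the `markov`
clause of `ChordalFamily.IsMarkovExtension` at `(D, F)` (Werner 2007 §3.2 (2)). [folklore] -/
theorem markov_clause_of_forall_integral (μ : Measure (CurveClass ℂ)) [IsFiniteMeasure μ]
    {F : Set ℂ} (hF : IsClosed F) (κ : Kernel (CurveClass ℂ) (CurveClass ℂ)) [IsFiniteKernel κ]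
    (h : ∀ f g : CurveClass ℂ →ᵇ ℝ,
      ∫ γ, f (γ.stopAt F) * g (γ.startFrom F) ∂μ =
        ∫ γ, f (γ.stopAt F) * (∫ η, g η ∂(κ (γ.stopAt F))) ∂μ)
    {S T : Set (CurveClass ℂ)} (hS : MeasurableSet S) (hT : MeasurableSet T) :
    μ (CurveClass.stopAt F ⁻¹' S ∩ CurveClass.startFrom F ⁻¹' T) =
      ∫⁻ γ in CurveClass.stopAt F ⁻¹' S, κ (γ.stopAt F) T ∂μ :=
  measure_inter_preimage_eq_setLIntegral_kernel_of_forall_integral μ (CurveClass.measurable_stopAt hF)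
    (CurveClass.measurable_startFrom hF) κ h hS hT

/-- **A domain-Markov extension from tensor test functions.** If the laws `P D` are finite, the finite
kernels `κ D` satisfy the `initial` and `domain` clauses, and for every Dobrushin domain `D` and closed `F` the
tensor identity holds against `P D`, then `fun D p => κ D p` is a Markov extension of `P`
(`ChordalFamily.IsMarkovExtension`). [folklore] -/
theorem isMarkovExtension_of_forall_integral (P : ChordalFamily) (hP : ∀ D, IsFiniteMeasure (P D))
    (κ : DobrushinDomain → Kernel (CurveClass ℂ) (CurveClass ℂ)) (hκ : ∀ D, IsFiniteKernel (κ D))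
    (hinit : ∀ D : DobrushinDomain, κ D (CurveClass.mk (Curve.const (D.pt 0))) = P D)
    (hdom : ∀ (D₁ D₂ : DobrushinDomain) (p₁ p₂ : CurveClass ℂ),
      remainingDomain D₁ p₁ = remainingDomain D₂ p₂ → p₁.target = p₂.target → D₁.pt 1 = D₂.pt 1 →
        κ D₁ p₁ = κ D₂ p₂)
    (h : ∀ (D : DobrushinDomain) (F : Set ℂ), IsClosed F → ∀ f g : CurveClass ℂ →ᵇ ℝ,
      ∫ γ, f (γ.stopAt F) * g (γ.startFrom F) ∂(P D) =
        ∫ γ, f (γ.stopAt F) * (∫ η, g η ∂(κ D (γ.stopAt F))) ∂(P D)) :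
    P.IsMarkovExtension fun D p => κ D p where
  initial := hinit
  markov D F hF S T hS hT := by
    haveI := hP D
    haveI := hκ D
    exact markov_clause_of_forall_integral (P D) hF (κ D) (h D F hF) hS hT
  domain := hdom


/-! ### Registered sub-goal of crux stmt-CriticalPhenomena-1370 (line `registered`, stub `stub_markovOfLimit`) -/

/-- **Registered sub-goal `stub_markovClauseFromTensors`** (crux stmt-CriticalPhenomena-1370, continuum half of the
Markov passage, part 1): the `markov` clause of `ChordalFamily.IsMarkovExtension` at `(D, F)` for a finite law `μ = P D`,
a closed `F` and a finite kernel `κ = Q D`, from the tensor test-function identity — all binders explicit, notation-free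
(`= markov_clause_of_forall_integral`). [folklore] -/
theorem stub_markovClauseFromTensors :
    ∀ (μ : MeasureTheory.Measure (Literature.Probability.RandomPlanarGeometry.CurveClass ℂ)) [MeasureTheory.IsFiniteMeasure μ] (F : Set ℂ), IsClosed F → ∀ (κ : ProbabilityTheory.Kernel (Literature.Probability.RandomPlanarGeometry.CurveClass ℂ) (Literature.Probability.RandomPlanarGeometry.CurveClass ℂ)) [ProbabilityTheory.IsFiniteKernel κ], (∀ f g : BoundedContinuousFunction (Literature.Probability.RandomPlanarGeometry.CurveClass ℂ) ℝ, MeasureTheory.integral μ (fun γ => f (γ.stopAt F) * g (γ.startFrom F)) = MeasureTheory.integral μ (fun γ => f (γ.stopAt F) * MeasureTheory.integral (κ (γ.stopAt F)) (fun η => g η))) → ∀ S T : Set (Literature.Probability.RandomPlanarGeometry.CurveClass ℂ), MeasurableSet S → MeasurableSet T → μ (Literature.Probability.RandomPlanarGeometry.CurveClass.stopAt F ⁻¹' S ∩ Literature.Probability.RandomPlanarGeometry.CurveClass.startFrom F ⁻¹' T) = MeasureTheory.lintegral (μ.restrict (Literature.Probability.RandomPlanarGeometry.CurveClass.stopAt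 F ⁻¹' S)) (fun γ => κ (γ.stopAt F) T) :=
  fun μ _ _ hF κ _ h _ _ hS hT => markov_clause_of_forall_integral μ hF κ h hS hT

end Markov

end Summit.CriticalPhenomena.SAWScalingLimit.Theorems.AxiomsOfLimitMarkov

end
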